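import Summits.BirchSwinnertonDyer.BirchSwinnertonDyer.Theses.PrintX9
import Summits.BirchSwinnertonDyer.BirchSwinnertonDyer.Theorems.PrintX9HowardContainmentLightFramePinnedOfPrintSharpOfMuPart
import HarnessLib

/-!
# TURNKEY (plan g10): closers for the split children of `PrintX9.HowardContainmentLightFramePinnedOfPrintSharp` (27077)

PrintX9 rev 36 (commit 98055358c9f1) declares `CoprimeTiedX9` (stmt-27473), `EnvelopeModulesSharpX9` (stmt-27474) (supports),
`MuPartSharpX9` (stmt-27475, CRUX, OPEN) and the glue `HowardContainmentLightFramePinnedOfPrintSharpOfSplit` (stmt-27476). This file closes the two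
supports and the glue BY NAME from landed theorems (p616846, p621799, p622945). Any prover:
`ledger propose --kind proof --target Summits/BirchSwinnertonDyer/BirchSwinnertonDyer/Theorems/PrintX9SplitClosers.lean --file <this> --workitem stmt-BirchSwinnertonDyer-27476`
(the gate matches the other two by type; else one proposal per item). «beyond-print theorem»: no. BSD is NOT proved by this file.
-/

set_option linter.dupNamespace false
set_option autoImplicit false

namespace Summit.BirchSwinnertonDyer.BirchSwinnertonDyer.Theorems.PrintX9Split

open Summit.BirchSwinnertonDyer.BirchSwinnertonDyer.Theses.PrintX9

/-- child 1/3 (support): the `p ∤ h_K` regime, PRINT (MZ26 Cor. 4.6). [cite: MastellaZerman2026, Cor. 4.6] -/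
theorem coprimeTiedX9_holds : CoprimeTiedX9 :=
  Summit.BirchSwinnertonDyer.BirchSwinnertonDyer.Theorems.PrintX9Rung.stmt_coprimeTied

/-- child 2/3 (support): the module-level envelope at every class number (the child's `Submodule.map (DistribSMul.toLinearMap …)`
is the scoped-pointwise `•` of the stub letter by definition). [cite: CastellaGrossiLeeSkinner2022, Rem. 4.1.4]
[cite: Howard2004HeegnerKolyvagin, §3.3, Thm. 3.3.7] [cite: PerrinRiou1987BSMF, §3.4 Prop. 10] -/
theorem envelopeModulesSharpX9_holds : EnvelopeModulesSharpX9 :=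
  Summit.BirchSwinnertonDyer.BirchSwinnertonDyer.Theorems.PrintX9SharpEnvelope.stub_envelopeModulesSharp

/-- the glue: the parent from its three children — the LEAD's conditional closer consumes the μ-part; the two supports are
consumed inside it by name. [cite: MastellaZerman2026, Cor. 4.6] [cite: CastellaGrossiSkinner2025, Thm. 6.5.2] -/
theorem howardContainmentLightFramePinnedOfPrintSharpOfSplit_holds : HowardContainmentLightFramePinnedOfPrintSharpOfSplit :=
  fun _ _ s_mu =>
    Summit.BirchSwinnertonDyer.BirchSwinnertonDyer.Theorems.PrintX9SharpMuPart.howardContainmentLightFramePinnedOfPrintSharp_of_muPartSharp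
      s_mu

end Summit.BirchSwinnertonDyer.BirchSwinnertonDyer.Theorems.PrintX9Split
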